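import Summits.AtomisticToContinuum.HydrodynamicLimit.Theorems.InformationPercolationEnginePercolationClosesChaosDockingDeterministic
import Summits.AtomisticToContinuum.HydrodynamicLimit.Theorems.InformationPercolationEnginePercolationClosesChaosDockingBudgetOrder
import Summits.AtomisticToContinuum.HydrodynamicLimit.Theorems.LambertianContactSwapSwapGapGibbsDomination
import Summits.AtomisticToContinuum.HydrodynamicLimit.Theorems.CollisionRate.Negative.TauNonposTrivial
import HarnessLib

/-!
# Docking S7 of the line `equilibrium-forecast-chain-rule` (crux `InformationPercolationEngine.PercolationClosesChaos`,
stmt-AtomisticToContinuum-15178) — piece G: the probabilistic assembly of the docking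

Support file (`--supports stmt-AtomisticToContinuum-15178`) of the registered stub
`stub_docking : KineticCellChaosLG → NoMesoscopicOscillation → LocalCountUI → ContactChaos` (worker S7 of lead c3).
`docking_of_aemeasurable` (registered helper G) proves the docking from the three kinetic statements GIVEN the two
a.e.-measurability facts of worker S7-M (unit averages of `badWeight` and of the truncated row counts are a.e.-measurable for
the Liouville measure), which are exactly what Markov's inequality under the local Gibbs law needs; `stub_docking` itself is
then `docking_of_aemeasurable aemeasurable_unitAvg_badWeight aemeasurable_unitAvg_rowCount_trunc` (separate file).

The assembly, for profiles `(a₀, θ₀, u₀)`: `σ₀ := min` of the thresholds of `KineticCellChaosLG`, `NoMesoscopicOscillation`,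
`LocalCountUI` (packing threshold `1`) and `1/2`. For `σ < σ₀`, a flow family, `τ, χ, Ψ (|Ψ| ≤ CΨ), η, δ`: `P := π σ³`,
`Cχ := sup |χ|` on `[0, τ+1] × 𝕋³` (compact), the energy constant `E₀ := 4A/δ + 1` from the second-moment bound
`E_LG[E] ≤ A (N+1)` (`LambertianContactSwapSwapGapGibbsDomination.exists_localGibbsLaw_dominated`, Markov:
`LG{E₀(N+1) < E} ≤ δ/4`); the tolerance `ηN` of the smallness budget `docking_budget'` (BEFORE `r₀`); `r₀` from
`NoMesoscopicOscillation` (i) at `(Ψ, ηN, δ/4)`; for `r < r₀` the sup / joint-Lipschitz constants of the two mollified pair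
fields `targetPm 1 = poolPairField 1`, `targetPm Ψ = poolPairField Ψ` (`abs_poolPairField_le`, `abs_poolPairField_sub_le`,
energy per particle `≤ E₀`); `b₂` from the budget; the level `T₂` from `LocalCountUI` (i) at horizon `2τ` and tolerance
`b₂ δ/4` (Markov: `LG{b₂ < unitAvg_{2τ}} ≤ δ/4`); `η₁, ρ, b₁` from the budget; the modulus `ϖ` of `χ` for `ρ` (uniform
continuity on the compact set; the sup-distance of `𝕋³` is dominated by the minimal-image distance,
`Torus.norm_sub_le_euclidDist_holds`); `c := max (c₀ of KineticCellChaosLG at (Ψ, η₁, b₁δ/4, 2T₂), c₀ of NMO (i) at r, 1)`;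
`Q := √(2 T₂ E₀ · c³/(π³σ⁶))` (`cellCount_eq`); the threshold `θ` of the budget; `N₀ := max` of the three `N₀`'s and of the
`N₁` beyond which `Δ_N ≤ min(θ, ϖ/3, τ, 1)` (`eventually_stepLen_le`). For `N ≥ N₀` the deterministic bound `abs_dockDefect_le`
(piece F2) shows `{z ∈ good | η < |dockDefect z|} ⊆ Bad_N ∪ Bad_K ∪ Bad_U ∪ Bad_E ∪ Contact₀` (on the complement
`|dockDefect| ≤ P · BOUND ≤ η`), so `LG(…) ≤ 4 · δ/4 + 0` (`measure_union_le`; the contact set at time `0` is `LG`-null,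
`CollisionRate.localGibbsLaw_setOf_exists_mem_contactSet`), and `measure_contactDefect_le` (piece A) turns this into the
`let`-goal of `ContactChaos`.

Bookkeeping (Markov, union bound); CIP 1994 §4.2, Spohn 1991 Part I Ch. 3 for the objects.
-/

noncomputable section

open MeasureTheory Set Filter Topology
open scoped ENNReal BigOperators Classical
open Literature.Analysis.FluidPDE Literature.MathematicalPhysics.KineticTheory
open Literature.MathematicalPhysics.KineticTheory.VelocityBlindPlacement

namespace Summit.AtomisticToContinuum.HydrodynamicLimit.Theorems.EquilibriumForecastLine

/-! ## Markov's inequality under the local Gibbs law; the localiser on a compact time slab -/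

/-- **Markov's inequality under the local Gibbs law, from a bound on the `lintegral` of `ENNReal.ofReal ∘ f`** (the form in
which `KineticCellChaosLG` and `LocalCountUI` (i) state their expectations): if `f` is a.e.-measurable for the Liouville measure
(hence for `LG ≪ liouville`) and `∫⁻ ofReal (f z) dLG ≤ ofReal (b · δ')` with `b > 0`, then `LG{b < f} ≤ ofReal δ'`.
[folklore] -/
theorem measure_lt_le_of_lintegral_le {σ : ℝ} {a₀ θ₀ : T3 → ℝ} {u₀ : T3 → V3} {N : ℕ} (Φ : Flow σ N) {f : Phase N → ℝ}
    (hf : AEMeasurable f (liouville G3 (N + 1) (hsDiameter σ N))) {b δ' : ℝ} (hb : 0 < b)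
    (h : ∫⁻ z, ENNReal.ofReal (f z) ∂(localGibbsLaw σ a₀ u₀ θ₀ N Φ) ≤ ENNReal.ofReal (b * δ')) :
    localGibbsLaw σ a₀ u₀ θ₀ N Φ {z | b < f z} ≤ ENNReal.ofReal δ' := by
  set μ := localGibbsLaw σ a₀ u₀ θ₀ N Φ with hμ
  have hac : μ ≪ liouville G3 (N + 1) (hsDiameter σ N) := by
    rw [hμ]
    unfold localGibbsLaw particleLaw
    exact withDensity_absolutelyContinuous _ _
  have hf' : AEMeasurable (fun z => ENNReal.ofReal (f z)) μ := ENNReal.measurable_ofReal.comp_aemeasurable (hf.mono_ac hac)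
  have hM := mul_meas_ge_le_lintegral₀ hf' (ENNReal.ofReal b)
  have hsub : {z | b < f z} ⊆ {z | ENNReal.ofReal b ≤ ENNReal.ofReal (f z)} :=
    Set.setOf_subset_setOf.2 fun z hz => ENNReal.ofReal_le_ofReal (le_of_lt hz)
  have h1 : ENNReal.ofReal b * μ {z | b < f z} ≤ ENNReal.ofReal b * ENNReal.ofReal δ' := by
    calc ENNReal.ofReal b * μ {z | b < f z} ≤ ENNReal.ofReal b * μ {z | ENNReal.ofReal b ≤ ENNReal.ofReal (f z)} :=
          mul_le_mul' le_rfl (measure_mono hsub)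
      _ ≤ ∫⁻ z, ENNReal.ofReal (f z) ∂μ := hM
      _ ≤ ENNReal.ofReal (b * δ') := h
      _ = ENNReal.ofReal b * ENNReal.ofReal δ' := ENNReal.ofReal_mul hb.le
  exact (ENNReal.mul_le_mul_iff_right (ENNReal.ofReal_pos.2 hb).ne' ENNReal.ofReal_ne_top).1 h1

/-- **Markov's inequality for the kinetic energy under the local Gibbs law**: with `E_LG[E] ≤ A (N+1)` and `E₀ > 0`,
`LG{E₀ (N+1) < E} ≤ ofReal (A / E₀)`. [folklore] -/
theorem measure_energy_gt_le {σ : ℝ} {a₀ θ₀ : T3 → ℝ} {u₀ : T3 → V3} {N : ℕ} (Φ : Flow σ N)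
    [IsFiniteMeasure (localGibbsLaw σ a₀ u₀ θ₀ N Φ)] {A E₀ : ℝ} (hE₀ : 0 < E₀)
    (hint : Integrable (configEnergy : Phase N → ℝ) (localGibbsLaw σ a₀ u₀ θ₀ N Φ))
    (hmean : ∫ z, configEnergy z ∂(localGibbsLaw σ a₀ u₀ θ₀ N Φ) ≤ A * ((N : ℝ) + 1)) :
    localGibbsLaw σ a₀ u₀ θ₀ N Φ {z | E₀ * ((N : ℝ) + 1) < configEnergy z} ≤ ENNReal.ofReal (A / E₀) := by
  set μ := localGibbsLaw σ a₀ u₀ θ₀ N Φ with hμ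
  have hN : (0 : ℝ) < (N : ℝ) + 1 := by positivity
  have h0 : 0 ≤ᵐ[μ] (configEnergy : Phase N → ℝ) := ae_of_all _ fun z => by
    show (0 : ℝ) ≤ configEnergy z
    unfold configEnergy; positivity
  have hM := mul_meas_ge_le_integral_of_nonneg h0 hint (E₀ * ((N : ℝ) + 1))
  have h1 : μ.real {z | E₀ * ((N : ℝ) + 1) ≤ configEnergy z} ≤ A / E₀ := by
    rw [le_div_iff₀ hE₀]
    have h2 := hM.trans hmean
    have h3 : 0 ≤ μ.real {z | E₀ * ((N : ℝ) + 1) ≤ configEnergy z} := measureReal_nonneg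
    nlinarith
  calc μ {z | E₀ * ((N : ℝ) + 1) < configEnergy z} ≤ μ {z | E₀ * ((N : ℝ) + 1) ≤ configEnergy z} :=
        measure_mono (Set.setOf_subset_setOf.2 fun z hz => le_of_lt hz)
    _ = ENNReal.ofReal (μ.real {z | E₀ * ((N : ℝ) + 1) ≤ configEnergy z}) :=
        (ENNReal.ofReal_toReal (measure_ne_top μ _)).symm
    _ ≤ ENNReal.ofReal (A / E₀) := ENNReal.ofReal_le_ofReal h1

/-- A uniform-continuity modulus of a continuous localiser on `[0, S] × 𝕋³` in the form the per-collision replacement consumes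
(time offset and minimal-image distance separately; the sup-distance of `𝕋³` is dominated by the minimal-image distance).
[folklore] -/
theorem exists_modulus_localiser {χ : ℝ × T3 → ℝ} (hχc : Continuous χ) (S : ℝ) {ρ : ℝ} (hρ : 0 < ρ) :
    ∃ ϖ : ℝ, 0 < ϖ ∧ ∀ p p' : ℝ × T3, p.1 ∈ Icc 0 S → p'.1 ∈ Icc 0 S → |p.1 - p'.1| < ϖ →
      Torus.euclidDist p.2 p'.2 < ϖ → |χ p - χ p'| ≤ ρ := by
  have hcpt : IsCompact ((Icc (0 : ℝ) S) ×ˢ (univ : Set T3)) := isCompact_Icc.prod isCompact_univ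
  obtain ⟨ϖ, hϖ, H⟩ := Metric.uniformContinuousOn_iff.1 (hcpt.uniformContinuousOn_of_continuous hχc.continuousOn) ρ hρ
  refine ⟨ϖ, hϖ, fun p p' hp hp' h1 h2 => ?_⟩
  have hd : dist p p' < ϖ := by
    rw [Prod.dist_eq, max_lt_iff, Real.dist_eq, dist_eq_norm]
    exact ⟨h1, (Torus.norm_sub_le_euclidDist_holds p.2 p'.2).trans_lt h2⟩
  have h := H p ⟨hp, mem_univ _⟩ p' ⟨hp', mem_univ _⟩ hd
  rw [Real.dist_eq] at h
  exact h.le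

/-- A sup bound of a continuous localiser on `[0, S] × 𝕋³` (compact). [folklore] -/
theorem exists_bound_localiser {χ : ℝ × T3 → ℝ} (hχc : Continuous χ) (S : ℝ) :
    ∃ Cχ : ℝ, 0 ≤ Cχ ∧ ∀ p : ℝ × T3, p.1 ∈ Icc 0 S → |χ p| ≤ Cχ := by
  have hcpt : IsCompact ((Icc (0 : ℝ) S) ×ˢ (univ : Set T3)) := isCompact_Icc.prod isCompact_univ
  obtain ⟨C, hC⟩ := hcpt.exists_bound_of_continuousOn hχc.continuousOn
  refine ⟨max C 0, le_max_right _ _, fun p hp => ?_⟩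
  have h := hC p ⟨hp, mem_univ _⟩
  rw [Real.norm_eq_abs] at h
  exact h.trans (le_max_left _ _)

/-! ## The assembly -/

set_option maxHeartbeats 400000 in
/-- **Registered helper `docking_of_aemeasurable` (piece G of the docking S7): the kinetic docking, given the two
a.e.-measurability facts.** From the a.e.-measurability (Liouville) of the unit averages of `badWeight Ψ η T` and of
`rowCount · 𝟙{T < rowCount}` (worker S7-M's registered stubs, taken here as hypotheses verbatim),
`KineticCellChaosLG → NoMesoscopicOscillation → LocalCountUI → ContactChaos`: constants in the quantifier order of the target
(module docstring), Markov (`measure_lt_le_of_lintegral_le`, `measure_energy_gt_le`), the deterministic bound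
`abs_dockDefect_le` on the complement of the five bad events, the union bound, and `measure_contactDefect_le`. [folklore] -/
theorem docking_of_aemeasurable : (∀ {σ : ℝ} {N : ℕ} (Φ : Flow σ N), 0 < σ → σ < 2⁻¹ → ∀ (Ψ : V3 × V3 × V3 → ℝ), Continuous Ψ → ∀ (η T c τ : ℝ), 0 ≤ T → 0 < c → AEMeasurable (fun z : Phase N => unitAvg c σ N τ (fun k q => badWeight Ψ η T c σ N Φ k q z)) (liouville G3 (N + 1) (hsDiameter σ N))) → (∀ {σ : ℝ} {N : ℕ} (Φ : Flow σ N), 0 < σ → σ < 2⁻¹ → ∀ (T c τ : ℝ), 0 < c → AEMeasurable (fun z : Phase N => unitAvg c σ N τ (fun k q => rowCount c σ N Φ k q z * (if T < rowCount c σ N Φ k q z then 1 else 0))) (liouville G3 (N + 1) (hsDiameter σ N))) → KineticCellChaosLG → NoMesoscopicOscillation → LocalCountUI → Summit.AtomisticToContinuum.HydrodynamicLimit.Theses.InformationPercolationEngine.ContactChaos := by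
  intro hMB hMU hKCC hNMO hUI a₀ θ₀ u₀ ha hθ hu ha0 hθ0
  obtain ⟨σK, hσK, HK⟩ := hKCC a₀ θ₀ u₀ ha hθ hu ha0 hθ0
  obtain ⟨σN, hσN, HN⟩ := hNMO a₀ θ₀ u₀ ha hθ hu ha0 hθ0
  obtain ⟨σU, hσU, HU⟩ := hUI 1 one_pos a₀ θ₀ u₀ ha hθ hu ha0 hθ0
  refine ⟨min (min σK σN) (min σU 2⁻¹), lt_min (lt_min hσK hσN) (lt_min hσU (by norm_num)), ?_⟩
  intro σ hσ hσ0 Φ τ hτ χ hχc Ψ hΨc hΨb η δ hη hδ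
  obtain ⟨CΨ, hΨ⟩ := hΨb
  have hσK' : σ < σK := hσ0.trans_le ((min_le_left _ _).trans (min_le_left _ _))
  have hσN' : σ < σN := hσ0.trans_le ((min_le_left _ _).trans (min_le_right _ _))
  have hσU' : σ < σU := hσ0.trans_le ((min_le_right _ _).trans (min_le_left _ _))
  have hσ2 : σ < 2⁻¹ := hσ0.trans_le ((min_le_right _ _).trans (min_le_right _ _))
  have hσhalf : σ ≤ 1 / 2 := by rw [one_div]; exact hσ2.le
  have hCΨ0 : 0 ≤ CΨ := (abs_nonneg _).trans (hΨ 0)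
  -- `P`, `S`, `Cχ`
  set P := Real.pi * σ ^ 3 with hP
  have hP0 : 0 < P := by positivity
  set S := τ + 1 with hS
  obtain ⟨Cχ, hCχ0, hχ⟩ := exists_bound_localiser hχc S
  -- the energy constant
  obtain ⟨A, bA, hA, -, Hdom⟩ :=
    LambertianContactSwapSwapGapGibbsDomination.exists_localGibbsLaw_dominated ha hθ hu ha0 hθ0 hσhalf
  set E₀ := 4 * A / δ + 1 with hE₀
  have hE₀0 : 0 < E₀ := by positivity
  have hAE : A / E₀ ≤ δ / 4 := by
    rw [div_le_div_iff₀ hE₀0 four_pos, hE₀]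
    have : δ * (4 * A / δ + 1) = 4 * A + δ := by field_simp
    nlinarith
  -- the tolerance `ηN` of the budget, before `r₀`
  obtain ⟨ηN, hηN, Hbud⟩ := docking_budget' P Cχ τ η hP0 hCχ0 hτ hη
  -- `NoMesoscopicOscillation` (i): the mollification radius
  obtain ⟨r₀, hr₀, HN1⟩ := (HN σ hσ hσN' Φ τ hτ).1 Ψ hΨc ⟨CΨ, hΨ⟩ ηN (δ / 4) hηN (by positivity)
  refine ⟨r₀, hr₀, fun r hr hrr₀ => ?_⟩
  -- the `r`-level constants of the two mollified pair fields
  set M3 := sphereMeasure.real (univ : Set (Metric.sphere (0 : V3) 1)) with hM3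
  have hM30 : 0 ≤ M3 := measureReal_nonneg
  set P₁ := (3 / (Real.pi * r ^ 3)) ^ 2 * (M3 * 1) * (1 + 2 * E₀) with hP₁
  set PΨ := (3 / (Real.pi * r ^ 3)) ^ 2 * (M3 * CΨ) * (1 + 2 * E₀) with hPΨ
  set L₁ := 2 * (3 / (Real.pi * r ^ 4)) * (3 / (Real.pi * r ^ 3)) * (M3 * 1 * (1 + 2 * E₀)) with hL₁
  set LΨ := 2 * (3 / (Real.pi * r ^ 4)) * (3 / (Real.pi * r ^ 3)) * (M3 * CΨ * (1 + 2 * E₀)) with hLΨ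
  set S₁ := τ * (r⁻¹ * P₁) with hS₁
  set SΨ := τ * (r⁻¹ * PΨ) with hSΨ
  set Kt₁ := τ * (r⁻¹ * r⁻¹ * P₁) with hKt₁
  set Kx₁ := τ * (r⁻¹ * L₁) with hKx₁
  set KtΨ := τ * (r⁻¹ * r⁻¹ * PΨ) with hKtΨ
  set KxΨ := τ * (r⁻¹ * LΨ) with hKxΨ
  have hS₁0 : 0 ≤ S₁ := by positivity
  have hSΨ0 : 0 ≤ SΨ := by positivity
  have hKt₁0 : 0 ≤ Kt₁ := by positivity
  have hKx₁0 : 0 ≤ Kx₁ := by positivity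
  have hKtΨ0 : 0 ≤ KtΨ := by positivity
  have hKxΨ0 : 0 ≤ KxΨ := by positivity
  obtain ⟨b₂, hb₂, -, Hb⟩ := Hbud CΨ S₁ SΨ Kt₁ Kx₁ KtΨ KxΨ hCΨ0 hS₁0 hSΨ0 hKt₁0 hKx₁0 hKtΨ0 hKxΨ0
  -- `LocalCountUI` (i) at horizon `2τ`: the level `T₂`
  obtain ⟨T₂, hT₂, HU1⟩ := (HU σ hσ hσU' Φ (2 * τ) (by positivity) (b₂ * (δ / 4)) (by positivity)).1
  obtain ⟨η₁, hη₁, ρ, hρ, b₁, hb₁, Hθ⟩ := Hb T₂ hT₂.le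
  -- the modulus of the localiser
  obtain ⟨ϖ, hϖ, hχuc⟩ := exists_modulus_localiser hχc S hρ
  -- the kinetic scale `c`
  obtain ⟨c₀K, hc₀K, HK1⟩ := HK σ hσ hσK' Φ τ hτ Ψ hΨc ⟨CΨ, hΨ⟩ η₁ (b₁ * (δ / 4)) (2 * T₂) hη₁ (by positivity)
    (by positivity)
  obtain ⟨c₀N, hc₀N, HN2⟩ := HN1 r hr hrr₀
  set c := max (max c₀K c₀N) 1 with hcdef
  have hc1 : (1 : ℝ) ≤ c := le_max_right _ _
  have hc : 0 < c := one_pos.trans_le hc1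
  obtain ⟨N₀K, HK2⟩ := HK1 c ((le_max_left _ _).trans (le_max_left _ _))
  obtain ⟨N₀N, HN3⟩ := HN2 c ((le_max_right _ _).trans (le_max_left _ _))
  obtain ⟨N₀U, HU2⟩ := HU1 c hc1
  -- the energy / cell-count constant `Q` and the step threshold `θ`
  set Q := Real.sqrt (2 * T₂ * E₀ * (c ^ 3 / (Real.pi ^ 3 * σ ^ 6))) with hQ
  obtain ⟨θs, hθs, Hfin⟩ := Hθ ϖ hϖ Q (Real.sqrt_nonneg _)
  obtain ⟨N₁, HN₁⟩ := eventually_stepLen_le (c := c) hσ (θ := min θs (min (ϖ / 3) (min τ 1))) (by positivity)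
  refine ⟨max (max N₀K N₀N) (max N₀U N₁), fun N hN => ?_⟩
  have hNK : N₀K ≤ N := ((le_max_left _ _).trans (le_max_left _ _)).trans hN
  have hNN : N₀N ≤ N := ((le_max_right _ _).trans (le_max_left _ _)).trans hN
  have hNU : N₀U ≤ N := ((le_max_left _ _).trans (le_max_right _ _)).trans hN
  have hN1 : N₁ ≤ N := ((le_max_right _ _).trans (le_max_right _ _)).trans hN
  -- the step length at this `N`
  set Δ := stepLen c σ N with hΔdef
  have hΔ : 0 < Δ := stepLen_pos hc hσ N
  have hΔle := HN₁ N hN1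
  have hΔθ : Δ ≤ θs := hΔle.trans (min_le_left _ _)
  have hΔϖ : Δ < ϖ / 2 := (hΔle.trans ((min_le_right _ _).trans (min_le_left _ _))).trans_lt (by linarith)
  have hΔτ : Δ ≤ τ := hΔle.trans ((min_le_right _ _).trans ((min_le_right _ _).trans (min_le_left _ _)))
  have hΔ1 : Δ ≤ 1 := hΔle.trans ((min_le_right _ _).trans ((min_le_right _ _).trans (min_le_right _ _)))
  have hbound := Hfin Δ hΔ hΔθ
  set μ := localGibbsLaw σ a₀ u₀ θ₀ N (Φ N) with hμ
  haveI : IsProbabilityMeasure μ := isProbabilityMeasure_localGibbsLaw ha hθ hu ha0 hθ0 hσhalf N (Φ N)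
  -- the five bad events
  set BadN := {z : Phase N | ηN < unitAvg c σ N τ fun k q => ∑' q' : Cell,
    collPair (fun _ => 1) c σ N (Φ N) k q q' z *
      |targetPm (fun _ => 1) r τ σ N (Φ N) z ((k : ℝ) * stepLen c σ N) (cellCentre c σ N q) *
          (pairPair Ψ c σ N (Φ N) k q q' z / pairPair (fun _ => 1) c σ N (Φ N) k q q' z) -
        targetPm Ψ r τ σ N (Φ N) z ((k : ℝ) * stepLen c σ N) (cellCentre c σ N q)|} with hBadN
  set BadK := {z : Phase N | b₁ < unitAvg c σ N τ (fun k q => badWeight Ψ η₁ (2 * T₂) c σ N (Φ N) k q z)} with hBadK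
  set BadU := {z : Phase N | b₂ < unitAvg c σ N (2 * τ)
    (fun k q => rowCount c σ N (Φ N) k q z * (if T₂ < rowCount c σ N (Φ N) k q z then 1 else 0))} with hBadU
  set BadE := {z : Phase N | E₀ * ((N : ℝ) + 1) < configEnergy z} with hBadE
  set C0 := {z : Phase N | ∃ i j : Fin (N + 1), i ≠ j ∧ z ∈ contactSet G3 (N + 1) (hsDiameter σ N) i j} with hC0
  have mN : μ BadN ≤ ENNReal.ofReal (δ / 4) := HN3 N hNN
  have mK : μ BadK ≤ ENNReal.ofReal (δ / 4) :=
    measure_lt_le_of_lintegral_le (Φ N) (hMB (Φ N) hσ hσ2 Ψ hΨc η₁ (2 * T₂) c τ (by positivity) hc) hb₁ (HK2 N hNK)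
  have mU : μ BadU ≤ ENNReal.ofReal (δ / 4) :=
    measure_lt_le_of_lintegral_le (Φ N) (hMU (Φ N) hσ hσ2 T₂ c (2 * τ) hc) hb₂ (HU2 N hNU)
  have mE : μ BadE ≤ ENNReal.ofReal (δ / 4) := by
    obtain ⟨-, -, -, hint, hmean⟩ := Hdom N (Φ N)
    exact (measure_energy_gt_le (Φ N) hE₀0 hint hmean).trans (ENNReal.ofReal_le_ofReal hAE)
  have m0 : μ C0 = 0 := CollisionRate.localGibbsLaw_setOf_exists_mem_contactSet hσ (Φ N)
  -- off the bad events the deterministic bound applies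
  have hsub : {z | z ∈ (Φ N).good ∧ η < |dockDefect χ Ψ r τ σ N (Φ N) z|} ⊆ BadN ∪ BadK ∪ BadU ∪ BadE ∪ C0 := by
    rintro z ⟨hz, hzη⟩
    by_contra hnot
    have hnN : z ∉ BadN := fun h => hnot (mem_union_left _ (mem_union_left _ (mem_union_left _ (mem_union_left _ h))))
    have hnK : z ∉ BadK := fun h => hnot (mem_union_left _ (mem_union_left _ (mem_union_left _ (mem_union_right _ h))))
    have hnU : z ∉ BadU := fun h => hnot (mem_union_left _ (mem_union_left _ (mem_union_right _ h)))
    have hnE : z ∉ BadE := fun h => hnot (mem_union_left _ (mem_union_right _ h))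
    have hn0 : z ∉ C0 := fun h => hnot (mem_union_right _ h)
    rw [hBadN, Set.mem_setOf_eq, not_lt] at hnN
    rw [hBadK, Set.mem_setOf_eq, not_lt] at hnK
    rw [hBadU, Set.mem_setOf_eq, not_lt] at hnU
    rw [hBadE, Set.mem_setOf_eq, not_lt] at hnE
    rw [hC0, Set.mem_setOf_eq] at hn0
    -- energy per particle of the datum
    have hNpos : (0 : ℝ) < ((N + 1 : ℕ) : ℝ) := by positivity
    have hE : ((N + 1 : ℕ) : ℝ)⁻¹ * configEnergy z ≤ E₀ := by
      rw [inv_mul_le_iff₀ hNpos]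
      push_cast
      linarith
    -- the mollified pair fields of the orbit
    have h1b : ∀ p : V3 × V3 × V3, |(fun _ : V3 × V3 × V3 => (1 : ℝ)) p| ≤ 1 := fun _ => by simp
    have hS1 : ∀ s x, |targetPm (fun _ => 1) r τ σ N (Φ N) z s x| ≤ S₁ := fun s x => by
      rw [hS₁, hP₁, targetPm_eq_poolPairField]
      exact abs_poolPairField_le hz h1b hr hτ.le hE (s, x)
    have hSΨ' : ∀ s x, |targetPm Ψ r τ σ N (Φ N) z s x| ≤ SΨ := fun s x => by
      rw [hSΨ, hPΨ, targetPm_eq_poolPairField]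
      exact abs_poolPairField_le hz hΨ hr hτ.le hE (s, x)
    have hL1 : ∀ s x s' x', |targetPm (fun _ => 1) r τ σ N (Φ N) z s x - targetPm (fun _ => 1) r τ σ N (Φ N) z s' x'| ≤
        Kt₁ * |s - s'| + Kx₁ * Torus.euclidDist x x' := fun s x s' x' => by
      rw [hKt₁, hKx₁, hP₁, hL₁, targetPm_eq_poolPairField, targetPm_eq_poolPairField]
      have h := abs_poolPairField_sub_le hz continuous_const h1b hr hτ.le hE (s, x) (s', x')
      dsimp only at h
      refine h.trans (le_of_eq ?_)
      ring
    have hLΨ : ∀ s x s' x', |targetPm Ψ r τ σ N (Φ N) z s x - targetPm Ψ r τ σ N (Φ N) z s' x'| ≤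
        KtΨ * |s - s'| + KxΨ * Torus.euclidDist x x' := fun s x s' x' => by
      rw [hKtΨ, hKxΨ, hPΨ, hLΨ, targetPm_eq_poolPairField, targetPm_eq_poolPairField]
      have h := abs_poolPairField_sub_le hz hΨc hΨ hr hτ.le hE (s, x) (s', x')
      dsimp only at h
      refine h.trans (le_of_eq ?_)
      ring
    -- the energy / cell-count constant
    have hQz : 2 * T₂ * (c * meanFreePath σ N) ^ 3 * configEnergy z ≤ Q ^ 2 := by
      rw [hQ, Real.sq_sqrt (by positivity), ← cellCount_eq c hσ N]
      unfold cellCount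
      calc 2 * T₂ * (c * meanFreePath σ N) ^ 3 * configEnergy z
          ≤ 2 * T₂ * (c * meanFreePath σ N) ^ 3 * (E₀ * ((N : ℝ) + 1)) := mul_le_mul_of_nonneg_left hnE (by positivity)
        _ = 2 * T₂ * E₀ * (((N : ℝ) + 1) * (c * meanFreePath σ N) ^ 3) := by ring
    have hF2 := abs_dockDefect_le (Φ N) hz hn0 hc hσ hσ2 χ hΨc r hτ hΔτ hΔ1 (S := S) (by rw [hS]; linarith) hχ hχuc hϖ
      hΔϖ hΨ hS1 hL1 hSΨ' hLΨ hKt₁0 hKx₁0 hKtΨ0 hKxΨ0 hT₂.le hη₁.le (Real.sqrt_nonneg _) hQz hnN hnK hnU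
    exact absurd (hF2.trans hbound) (not_le.2 hzη)
  -- the union bound
  have hfin : μ {z | z ∈ (Φ N).good ∧ η < |dockDefect χ Ψ r τ σ N (Φ N) z|} ≤ ENNReal.ofReal δ := by
    have hδ4 : 0 ≤ δ / 4 := by positivity
    calc μ {z | z ∈ (Φ N).good ∧ η < |dockDefect χ Ψ r τ σ N (Φ N) z|} ≤ μ (BadN ∪ BadK ∪ BadU ∪ BadE ∪ C0) :=
          measure_mono hsub
      _ ≤ μ (BadN ∪ BadK ∪ BadU ∪ BadE) + μ C0 := measure_union_le _ _
      _ ≤ μ (BadN ∪ BadK ∪ BadU) + μ BadE + μ C0 := by gcongr; exact measure_union_le _ _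
      _ ≤ μ (BadN ∪ BadK) + μ BadU + μ BadE + μ C0 := by gcongr; exact measure_union_le _ _
      _ ≤ μ BadN + μ BadK + μ BadU + μ BadE + μ C0 := by gcongr; exact measure_union_le _ _
      _ ≤ ENNReal.ofReal (δ / 4) + ENNReal.ofReal (δ / 4) + ENNReal.ofReal (δ / 4) + ENNReal.ofReal (δ / 4) + 0 := by
          gcongr
          exact m0.le
      _ = ENNReal.ofReal δ := by
          rw [add_zero, ← ENNReal.ofReal_add hδ4 hδ4, ← ENNReal.ofReal_add (by positivity) hδ4,
            ← ENNReal.ofReal_add (by positivity) hδ4]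
          congr 1
          ring
  exact measure_contactDefect_le (Φ N) a₀ θ₀ u₀ χ Ψ r τ η (ENNReal.ofReal δ) hfin

end Summit.AtomisticToContinuum.HydrodynamicLimit.Theorems.EquilibriumForecastLine

end
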